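import Literature.NumberTheory.Automorphic.ArchEndoscopicCentralDescent     -- ★ p841432 (R3-f) 2b: `sum_integral_pi_erase_eq_zero_of_eventuallyEq` (one descent step), `mul_exp_ne_mul_exp_neg`, `pi_dirac_eq_dirac`
import HarnessLib

/-!
# The descent to the centre under the `G`-REGULAR-only hypothesis (R3 STEP 3 node (3D); Rogawski 1990 §14.5 Lemma 14.5.2 (c) p. 238)

Topic `NumberTheory/Automorphic`; namespace `Literature.NumberTheory.Automorphic.UnitaryGroup`.  THEOREMS ONLY (no `def`, no instance, no notation, no axiom, no named fact, no `sorry`).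
Cell `pub/hodgecm-mathlib`, ENGINE T1 (crux H413 = `stmt-HodgeConjecture-24833`); ROAD-Sd residual R3 «(S-c) central vanishing» (`stub_ScCore` of `Cruxes/H413/Lines/F0_P3a_SdArch.lean`), STEP 3
node (3D) of the integration census `CENSUS-R3-STEP3-Integration` b54b3c40 (pen of record F0P3a-p03 (g10), LEAD WORD T8-76 (C)).

WHY.  ★ `apply_center_eq_zero_of_forall_sum_integral_pi_eq_zero` (F0P3a-p02, p841432 §3) descends to the centre from the vanishing of the symmetrised mixed orbital integrals
`Σ_ε ∫ Θ d(⊗ M(S₀, u, ε))` for EVERY torus datum `u` that is REGULAR on `S₀` (`u_w 0 ≠ u_w 1`).  But the source of that vanishing — the endoscopic identity (vi) `IsArchDeltaTransfer` read in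
Haar currency (★ `ArchDeltaTransferHaarForm`) — speaks only at `G`-REGULAR points of `H_∞ = U(Φ₂)_∞ × U(Φ₁)_∞`, i.e. at torus data whose 2-block angles are distinct AND differ from the frozen
central `U(Φ₁)`-angle `z_w` (three distinct eigenvalues in `G_∞`).  This file re-runs the downward induction of ★ §3 with the stronger invariant «`u_w 0 ≠ u_w 1`, `u_w 0 ≠ z_w`, `u_w 1 ≠ z_w`
on the live places»: the induction step is ★ §2 `sum_integral_pi_erase_eq_zero_of_eventuallyEq` VERBATIM (it only needs plain regularity off `w₁`), and the invariant survives because the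
central-curve angles `z_w e^{±iψ}` (`0 < |ψ| < 1`) are distinct (★ `mul_exp_ne_mul_exp_neg`) and both differ from `z_w` (`mul_exp_ne_self` below: `e^{iψ} ≠ 1`).
WHAT IS PROVED: `mul_exp_ne_self`, `mul_exp_neg_ne_self` (§0) and **`apply_center_eq_zero_of_forall_sum_integral_pi_eq_zero_of_ne_center`** (§1) — the statement of ★ §3 with `hQ` weakened
to `∀ u, (∀ w ∈ S₀, u w 0 ≠ u w 1 ∧ u w 0 ≠ z w ∧ u w 1 ≠ z w) → Σ_ε ∫ Θ d(⊗ M(S₀, u, ε)) = 0`.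
HONEST LABEL: HC_CM is proved only modulo the 7 printed citations until rung 0 closes; this file is induction bookkeeping over ★ p841432 and pays nothing by itself.

## References
* [Rogawski1990] J. D. Rogawski, *Automorphic Representations of Unitary Groups in Three Variables*, Ann. of Math. Stud. 123 (1990), §14.5 Lemma 14.5.2 (c) p. 238; §8.4 pp. 126–127.
* [Varadarajan1989] V. S. Varadarajan, *An Introduction to Harmonic Analysis on Semisimple Lie Groups* (1989), §6.4 Thm. 22.
-/

set_option autoImplicit false

noncomputable section

open MeasureTheory Matrix NumberField NumberField.InfinitePlace NumberField.mixedEmbedding Set Function Filter Topology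
open scoped MatrixGroups ContDiff Real
open scoped Matrix.Norms.Operator

namespace Literature.NumberTheory.Automorphic.UnitaryGroup

/-! ## §0 The central-curve angles differ from the central angle -/

section Small

/-- On `0 < |ψ| < 1`: `z e^{iψ} ≠ z` (`e^{iψ} = 1` forces `ψ ∈ 2πℤ`). [cite: Rogawski1990, §8.4 pp. 126–127] -/
theorem mul_exp_ne_self (z : Circle) {ψ : ℝ} (hψ : ψ ∈ Ioo (-1 : ℝ) 1) (hψ0 : ψ ≠ 0) : z * Circle.exp ψ ≠ z := by
  intro h
  have h1 : Circle.exp ψ = 1 := mul_left_cancel (h.trans (mul_one z).symm)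
  rw [← Circle.exp_zero] at h1
  obtain ⟨m, hm⟩ := Circle.exp_eq_exp.1 h1
  have hm' : ψ = m * (2 * π) := by linarith
  rcases lt_trichotomy m 0 with hneg | hzero | hpos
  · have : (m : ℝ) ≤ -1 := by exact_mod_cast Int.le_sub_one_of_lt hneg
    nlinarith [hψ.1, Real.pi_gt_three]
  · exact hψ0 (by rw [hm', hzero]; simp)
  · have : (1 : ℝ) ≤ m := by exact_mod_cast hpos
    nlinarith [hψ.2, Real.pi_gt_three]

/-- On `0 < |ψ| < 1`: `z e^{−iψ} ≠ z`. [cite: Rogawski1990, §8.4 pp. 126–127] -/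
theorem mul_exp_neg_ne_self (z : Circle) {ψ : ℝ} (hψ : ψ ∈ Ioo (-1 : ℝ) 1) (hψ0 : ψ ≠ 0) : z * Circle.exp (-ψ) ≠ z :=
  mul_exp_ne_self z ⟨by linarith [hψ.2], by linarith [hψ.1]⟩ (neg_ne_zero.2 hψ0)

end Small

/-! ## §1 The descent under the `G`-regular-only hypothesis -/

section Descent

variable (L : Type) [Field L] [NumberField L] [IsCMField L] (α : Fin 2 → L)
  [∀ w : {w : InfinitePlace L // IsComplex w}, MeasurableSpace (archLocal L 2 (Matrix.diagonal α) w)]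
  [∀ w : {w : InfinitePlace L // IsComplex w}, BorelSpace (archLocal L 2 (Matrix.diagonal α) w)]
  (νw : ∀ w : {w : InfinitePlace L // IsComplex w}, Measure (archLocal L 2 (Matrix.diagonal α) w)) [∀ w, (νw w).IsHaarMeasure]
  (z : {w : InfinitePlace L // IsComplex w} → Circle)

open scoped Classical in
/-- **THE DESCENT TO THE CENTRE, `G`-REGULAR HYPOTHESIS.**  On the endoscopic-type 2-block (`σ_wα` real of opposite signs at EVERY complex place): if for every torus datum `u` which is
`G`-REGULAR on `S₀` — `u_w 0 ≠ u_w 1` AND `u_w 0 ≠ z_w`, `u_w 1 ≠ z_w` (the 2-block eigenvalues also avoid the frozen central `U(Φ₁)`-angle) — the symmetrised mixed orbital integral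
`Σ_ε ∫ Θ d(⊗ M(S₀, u, ε))` vanishes, then `Θ` VANISHES AT THE CENTRE `(diag(z_w, z_w))_w`.  Same downward induction as ★ `apply_center_eq_zero_of_forall_sum_integral_pi_eq_zero` (each step
★ `sum_integral_pi_erase_eq_zero_of_eventuallyEq` with `r = 0`), the stronger invariant surviving along the central curve because `z e^{±iψ} ∉ {z}` for `0 < |ψ| < 1`.
[cite: Rogawski1990, §14.5 Lemma 14.5.2 (c) p. 238; §8.4 pp. 126–127] [cite: Varadarajan1989, §6.4 Thm. 22] -/
theorem apply_center_eq_zero_of_forall_sum_integral_pi_eq_zero_of_ne_center {E : Type*} [NormedAddCommGroup E] [NormedSpace ℝ E] [CompleteSpace E]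
    (hα : ∀ i, α i ≠ 0) (Θ : Matrix (Fin 2) (Fin 2) (mixedSpace L) → E) (hΘ : ContDiff ℝ (⊤ : ℕ∞) Θ)
    (hΘc : HasCompactSupport (fun g : arch (↥(maximalRealSubfield L)) L (IsCMField.complexConj L) 2 (Matrix.diagonal α) =>
      Θ ((g : GL (Fin 2) (mixedSpace L)) : Matrix (Fin 2) (Fin 2) (mixedSpace L))))
    (hreal : ∀ (w : {w : InfinitePlace L // IsComplex w}) (i : Fin 2), (w.1.embedding (α i)).im = 0)
    (hsgn : ∀ w : {w : InfinitePlace L // IsComplex w}, (w.1.embedding (α 0)).re * (w.1.embedding (α 1)).re < 0)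
    (S₀ : Finset {w : InfinitePlace L // IsComplex w})
    (hQ : ∀ u : {w : InfinitePlace L // IsComplex w} → Fin 2 → Circle, (∀ w ∈ S₀, u w 0 ≠ u w 1 ∧ u w 0 ≠ z w ∧ u w 1 ≠ z w) →
      ∑ ε : {w : InfinitePlace L // IsComplex w} → Bool,
        ∫ o, Θ (((((archPiEquivCM 2 L (Matrix.diagonal α)).symm o) : arch (↥(maximalRealSubfield L)) L (IsCMField.complexConj L) 2 (Matrix.diagonal α)) : GL (Fin 2) (mixedSpace L)) : Matrix (Fin 2) (Fin 2) (mixedSpace L))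
          ∂(Measure.pi (fun w : {w : InfinitePlace L // IsComplex w} =>
          if w ∈ S₀ then (νw w).map (fun g : archLocal L 2 (Matrix.diagonal α) w =>
            g * ⟨circleDiagonal 2 (if ε w then u w ∘ ⇑(Equiv.swap (0 : Fin 2) 1) else u w), circleDiagonal_mem_archLocal_diagonal L 2 α w _⟩ * g⁻¹)
          else Measure.dirac (⟨circleDiagonal 2 ![z w, z w], circleDiagonal_mem_archLocal_diagonal L 2 α w _⟩ : archLocal L 2 (Matrix.diagonal α) w))) = 0) :
    Θ (((((archPiEquivCM 2 L (Matrix.diagonal α)).symm (fun w : {w : InfinitePlace L // IsComplex w} => (⟨circleDiagonal 2 ![z w, z w], circleDiagonal_mem_archLocal_diagonal L 2 α w _⟩ : archLocal L 2 (Matrix.diagonal α) w))) : arch (↥(maximalRealSubfield L)) L (IsCMField.complexConj L) 2 (Matrix.diagonal α)) : GL (Fin 2) (mixedSpace L)) : Matrix (Fin 2) (Fin 2) (mixedSpace L)) = 0 := by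
  haveI : ∀ w : {w : InfinitePlace L // IsComplex w}, SecondCountableTopology (archLocal L 2 (Matrix.diagonal α) w) := fun w => secondCountableTopology_archLocal L 2 (Matrix.diagonal α) w
  -- downward induction: the hypothesis descends from `S₀` to `S₀ ∖ T` for every `T`, for `G`-regular data
  have key : ∀ (T : Finset {w : InfinitePlace L // IsComplex w}) (u : {w : InfinitePlace L // IsComplex w} → Fin 2 → Circle),
      (∀ w ∈ S₀ \ T, u w 0 ≠ u w 1 ∧ u w 0 ≠ z w ∧ u w 1 ≠ z w) →
      ∑ ε : {w : InfinitePlace L // IsComplex w} → Bool,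
        ∫ o, Θ (((((archPiEquivCM 2 L (Matrix.diagonal α)).symm o) : arch (↥(maximalRealSubfield L)) L (IsCMField.complexConj L) 2 (Matrix.diagonal α)) : GL (Fin 2) (mixedSpace L)) : Matrix (Fin 2) (Fin 2) (mixedSpace L))
          ∂(Measure.pi (fun w : {w : InfinitePlace L // IsComplex w} =>
          if w ∈ (S₀ \ T) then (νw w).map (fun g : archLocal L 2 (Matrix.diagonal α) w =>
            g * ⟨circleDiagonal 2 (if ε w then u w ∘ ⇑(Equiv.swap (0 : Fin 2) 1) else u w), circleDiagonal_mem_archLocal_diagonal L 2 α w _⟩ * g⁻¹)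
          else Measure.dirac (⟨circleDiagonal 2 ![z w, z w], circleDiagonal_mem_archLocal_diagonal L 2 α w _⟩ : archLocal L 2 (Matrix.diagonal α) w))) = 0 := by
    intro T
    induction T using Finset.induction_on with
    | empty =>
      intro u hu
      rw [Finset.sdiff_empty] at hu ⊢
      exact hQ u hu
    | insert w₁ T hw₁T ih =>
      intro u hu
      rw [Finset.sdiff_insert] at hu ⊢
      by_cases hmem : w₁ ∈ S₀ \ T
      · refine sum_integral_pi_erase_eq_zero_of_eventuallyEq L α νw z hα Θ hΘ hΘc (S₀ \ T) w₁ hmem (hreal w₁) (hsgn w₁) u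
          (fun w hw hne => (hu w (Finset.mem_erase.2 ⟨hne, hw⟩)).1) (fun _ => 0)
          (Filter.Eventually.of_forall fun ψ => differentiableAt_const (0 : E)) ?_ ?_
        · simp only [deriv_const']
          exact tendsto_const_nhds
        · have hIoo : ∀ᶠ ψ : ℝ in 𝓝[≠] 0, ψ ∈ Ioo (-1 : ℝ) 1 ∧ ψ ≠ 0 :=
            Filter.inter_mem (mem_nhdsWithin_of_mem_nhds (Ioo_mem_nhds (by norm_num) (by norm_num))) self_mem_nhdsWithin
          filter_upwards [hIoo] with ψ hψ
          rw [ih _ ?_, smul_zero]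
          intro w hw
          by_cases h : w = w₁
          · subst h
            rw [Function.update_self]
            exact ⟨mul_exp_ne_mul_exp_neg (z w) hψ.1 hψ.2, mul_exp_ne_self (z w) hψ.1 hψ.2, mul_exp_neg_ne_self (z w) hψ.1 hψ.2⟩
          · rw [Function.update_of_ne h]
            exact hu w (Finset.mem_erase.2 ⟨h, hw⟩)
      · rw [Finset.erase_eq_of_notMem hmem]
        exact ih u fun w hw => hu w (Finset.mem_erase.2 ⟨ne_of_mem_of_not_mem hw hmem, hw⟩)
  -- `T = S₀`: every place carries the Dirac mass at the centre
  have h0 := key S₀ (fun _ => ![1, 1]) (fun w hw => absurd hw (by rw [Finset.sdiff_self]; exact Finset.notMem_empty w))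
  rw [Finset.sdiff_self] at h0
  simp only [Finset.notMem_empty, ↓reduceIte] at h0
  rw [pi_dirac_eq_dirac, integral_dirac, Finset.sum_const, Finset.card_univ, ← Nat.cast_smul_eq_nsmul ℝ] at h0
  exact (smul_eq_zero.1 h0).resolve_left (Nat.cast_ne_zero.2 Fintype.card_ne_zero)

end Descent

end Literature.NumberTheory.Automorphic.UnitaryGroup

end
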